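import Summits.CriticalPhenomena.CardyFormulaZ2.Theorems.CardyIKTransportIKLinearTransportStubConditionalRSWFlips
import Summits.CriticalPhenomena.CardyFormulaZ2.Theorems.CardyIKTransportIKLinearTransportStubCouplingToLimitsEvents
import Summits.CriticalPhenomena.CardyFormulaZ2.Theorems.CardyIKTransportIKLinearTransportStubPinnedExchange
import Summits.CriticalPhenomena.CardyFormulaZ2.Theorems.CardyIKTransportIKMixedBoxCrossingDefectStubCondBox

/-!
# The GAUGE side of `stub_Screening` (crux stmt-CriticalPhenomena-5076, line `pinned-diagram-exchange`):
# the anchored shear of the axis bits and the colour formula it produces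

Support file (`--supports stmt-CriticalPhenomena-5076`) proving the registered sub-goals
`screenShear_measurePreserving`, `mem_blackSet_screenShear`, `inPar_span_far_top`, `inPar_span_far_right`,
`inPar_span_far_bottom`, `inPar_span_far_left`, `outPar_rect0_near` of the open stub `stub_Screening`.

SETTING. Near region of cells `N = [x₁, x₂) × [y₁, y₂)`; INTERNAL faces of `N` (all four corners in `N`):
`intF = [x₁, x₂ - 1) × [y₁, y₂ - 1)`, faces labelled by their lower-left cell as pairs `(c, r) : ℤ × ℤ`. The
gauge colour: `v` black iff `v 0 ∈ ω.1 ⊕ v 1 ∈ ω.2.1 ⊕ Odd #(plaquettes of parSet S ω in rect0 (v 0) (v 1))`.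
SHEAR: XOR the column bits `ω.1` with `colShift ω = {x | inPar (rect0 x y₂)}` and the row bits `ω.2.1` with
`rowShift ω = {y | inPar (rect0 x₂ y) ⊕ inPar (rect0 x₂ y₂)}` (parities of INTERNAL plaquettes only, anchor
`(x₂, y₂)`). It is `μIK`-preserving (the axis bits are fair and independent of the plaquettes: two skew
products, `measurePreserving_swapSkew`, `crsw_sitePercolation_half_map_symmDiff`) and afterwards `v` is black
iff `v 0 ∈ ω.1 ⊕ v 1 ∈ ω.2.1 ⊕ outPar (rect0 (v 0) (v 1)) ⊕ inPar (spanRect (v 0) (v 1) x₂ y₂)`: the four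
anchored internal parities telescope (Chasles mod 2 in each coordinate, `sum_Ico_minmax_chasles`) to the
parity of the rectangle SPANNED by `v` and the anchor. For FAR cells that parity is a parity of full internal
COLUMN parities (`v` below `N`), of full internal ROW parities (`v` left of `N`) or empty (`v` above / right
of `N`); for NEAR cells the external part `outPar (rect0 v)` is ADDITIVE (`C ⊕ F(v 0) ⊕ G(v 1)`), again by
Chasles mod 2, the piece `[x₁, v 0) × [y₁, v 1)` being internal. All parities are computed as indicator sums
in `ZMod 2` (`odd_card_filter_iff` of the stmt-5911 line).
-/

noncomputable section

namespace Summit.CriticalPhenomena.CardyFormulaZ2.Theorems.IKLinearTransport.PinnedDiagramExchange.ScreeningGauge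

open scoped Classical symmDiff
open MeasureTheory Finset
open Literature.Probability.Percolation Literature.Probability.LatticeModels
open Summit.CriticalPhenomena.CardyFormulaZ2.Cruxes.IKMixedBoxCrossing.DefectClosureExploration.CondBoxStub
  (odd_card_filter_iff)

/-- The anchored rectangle of plaquettes between `0` and `(x, y)` read by `blackSet`. [folklore] -/
def rect0 (x y : ℤ) : Finset (ℤ × ℤ) := Finset.Ico (min 0 x) (max 0 x) ×ˢ Finset.Ico (min 0 y) (max 0 y)

/-- The rectangle of plaquettes spanned by the cells `(x, y)` and `(x', y')`. [folklore] -/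
def spanRect (x y x' y' : ℤ) : Finset (ℤ × ℤ) := Finset.Ico (min x x') (max x x') ×ˢ Finset.Ico (min y y') (max y y')

/-- Internal faces of the near region `[x₁, x₂) × [y₁, y₂)`. [folklore] -/
def intF (x₁ x₂ y₁ y₂ : ℤ) : Finset (ℤ × ℤ) := Finset.Ico x₁ (x₂ - 1) ×ˢ Finset.Ico y₁ (y₂ - 1)

/-- The plaquette bit of the face `f` read by the pattern `S`. [folklore] -/
def plaq (S : Set ℤ) (ω : Ω) (f : ℤ × ℤ) : Prop := (![f.1, f.2] : Site 2) ∈ parSet S ω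

/-- Parity of the INTERNAL plaquettes of `R`. [folklore] -/
def inPar (S : Set ℤ) (x₁ x₂ y₁ y₂ : ℤ) (ω : Ω) (R : Finset (ℤ × ℤ)) : Prop :=
  Odd ((R ∩ intF x₁ x₂ y₁ y₂).filter (plaq S ω)).card

/-- Parity of the EXTERNAL plaquettes of `R`. [folklore] -/
def outPar (S : Set ℤ) (x₁ x₂ y₁ y₂ : ℤ) (ω : Ω) (R : Finset (ℤ × ℤ)) : Prop :=
  Odd ((R \ intF x₁ x₂ y₁ y₂).filter (plaq S ω)).card

/-- Parity of the internal face column `c` (rows `[y₁, y₂ - 1)`). [folklore] -/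
def colParity (S : Set ℤ) (y₁ y₂ : ℤ) (ω : Ω) (c : ℤ) : Prop :=
  Odd (((Finset.Ico y₁ (y₂ - 1)).filter fun r => plaq S ω (c, r)).card)

/-- Parity of the internal face row `r` (columns `[x₁, x₂ - 1)`). [folklore] -/
def rowParity (S : Set ℤ) (x₁ x₂ : ℤ) (ω : Ω) (r : ℤ) : Prop :=
  Odd (((Finset.Ico x₁ (x₂ - 1)).filter fun c => plaq S ω (c, r)).card)

/-- Column shift of the shear: `x ↦ inPar (rect0 x y₂)`. [folklore] -/
def colShift (S : Set ℤ) (x₁ x₂ y₁ y₂ : ℤ) (ω : Ω) : Set ℤ := {x | inPar S x₁ x₂ y₁ y₂ ω (rect0 x y₂)}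

/-- Row shift of the shear: `y ↦ inPar (rect0 x₂ y) ⊕ inPar (rect0 x₂ y₂)`. [folklore] -/
def rowShift (S : Set ℤ) (x₁ x₂ y₁ y₂ : ℤ) (ω : Ω) : Set ℤ :=
  {y | Xor (inPar S x₁ x₂ y₁ y₂ ω (rect0 x₂ y)) (inPar S x₁ x₂ y₁ y₂ ω (rect0 x₂ y₂))}

/-- THE ANCHORED SHEAR of the axis bits (plaquettes and coins untouched). [folklore] -/
def screenShear (S : Set ℤ) (x₁ x₂ y₁ y₂ : ℤ) (ω : Ω) : Ω :=
  (ω.1 ∆ colShift S x₁ x₂ y₁ y₂ ω, ω.2.1 ∆ rowShift S x₁ x₂ y₁ y₂ ω, ω.2.2)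

/-! ## §A Parity bookkeeping in `ZMod 2` -/

/-- The internal parity of a product rectangle as a double indicator sum in `ZMod 2`. [folklore] -/
theorem inPar_product_iff (S : Set ℤ) (x₁ x₂ y₁ y₂ : ℤ) (ω : Ω) (I J : Finset ℤ) :
    inPar S x₁ x₂ y₁ y₂ ω (I ×ˢ J) ↔
      (∑ c ∈ I, ∑ r ∈ J, if (c, r) ∈ intF x₁ x₂ y₁ y₂ then (if plaq S ω (c, r) then (1 : ZMod 2) else 0)
        else 0) = 1 := by
  unfold inPar
  rw [odd_card_filter_iff, ← Finset.sum_ite_mem, Finset.sum_product]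

/-- The external parity of a product rectangle as a double indicator sum in `ZMod 2`. [folklore] -/
theorem outPar_product_iff (S : Set ℤ) (x₁ x₂ y₁ y₂ : ℤ) (ω : Ω) (I J : Finset ℤ) :
    outPar S x₁ x₂ y₁ y₂ ω (I ×ˢ J) ↔
      (∑ c ∈ I, ∑ r ∈ J, if (c, r) ∉ intF x₁ x₂ y₁ y₂ then (if plaq S ω (c, r) then (1 : ZMod 2) else 0)
        else 0) = 1 := by
  unfold outPar
  rw [odd_card_filter_iff, Finset.sdiff_eq_filter, Finset.sum_filter, Finset.sum_product]

/-- Chasles mod 2 in the COLUMN range of a double sum over anchored intervals. [folklore] -/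
theorem sum2_chasles_fst (h : ℤ → ℤ → ZMod 2) (J : Finset ℤ) (x y z : ℤ) :
    ∑ c ∈ Finset.Ico (min x z) (max x z), ∑ r ∈ J, h c r =
      ∑ c ∈ Finset.Ico (min x y) (max x y), ∑ r ∈ J, h c r +
        ∑ c ∈ Finset.Ico (min y z) (max y z), ∑ r ∈ J, h c r :=
  sum_Ico_minmax_chasles (fun c => ∑ r ∈ J, h c r) x y z

/-- Chasles mod 2 in the ROW range of a double sum over anchored intervals. [folklore] -/
theorem sum2_chasles_snd (h : ℤ → ℤ → ZMod 2) (I : Finset ℤ) (x y z : ℤ) :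
    ∑ c ∈ I, ∑ r ∈ Finset.Ico (min x z) (max x z), h c r =
      ∑ c ∈ I, ∑ r ∈ Finset.Ico (min x y) (max x y), h c r +
        ∑ c ∈ I, ∑ r ∈ Finset.Ico (min y z) (max y z), h c r := by
  rw [← Finset.sum_add_distrib]
  exact Finset.sum_congr rfl fun c _ => sum_Ico_minmax_chasles (h c) x y z

/-- Splitting the plaquette parity of `R` into its internal and external parts. [folklore] -/
theorem odd_filter_iff_xor_inPar_outPar (S : Set ℤ) (x₁ x₂ y₁ y₂ : ℤ) (ω : Ω) (R : Finset (ℤ × ℤ)) :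
    Odd ((R.filter (plaq S ω)).card) ↔ Xor (inPar S x₁ x₂ y₁ y₂ ω R) (outPar S x₁ x₂ y₁ y₂ ω R) := by
  unfold inPar outPar
  rw [odd_card_filter_iff, odd_card_filter_iff, odd_card_filter_iff,
    ← Finset.sum_inter_add_sum_sdiff R (intF x₁ x₂ y₁ y₂)]
  have hx : ∀ u w : ZMod 2, u + w = 1 ↔ Xor (u = 1) (w = 1) := by decide
  exact hx _ _

/-- TELESCOPING of the four anchored internal parities to the spanned rectangle:
`inPar (rect0 a b) = inPar (rect0 a b') ⊕ inPar (rect0 a' b) ⊕ inPar (rect0 a' b') ⊕ inPar (spanRect a b a' b')`. [folklore] -/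
theorem inPar_rect0_iff (S : Set ℤ) (x₁ x₂ y₁ y₂ : ℤ) (ω : Ω) (a b a' b' : ℤ) :
    inPar S x₁ x₂ y₁ y₂ ω (rect0 a b) ↔
      Xor (inPar S x₁ x₂ y₁ y₂ ω (rect0 a b')) (Xor (inPar S x₁ x₂ y₁ y₂ ω (rect0 a' b))
        (Xor (inPar S x₁ x₂ y₁ y₂ ω (rect0 a' b')) (inPar S x₁ x₂ y₁ y₂ ω (spanRect a b a' b')))) := by
  obtain ⟨h, H⟩ : ∃ h : ℤ → ℤ → ZMod 2, ∀ I J : Finset ℤ,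
      (inPar S x₁ x₂ y₁ y₂ ω (I ×ˢ J) ↔ (∑ c ∈ I, ∑ r ∈ J, h c r) = 1) :=
    ⟨_, inPar_product_iff S x₁ x₂ y₁ y₂ ω⟩
  simp only [rect0, spanRect, H]
  rw [sum2_chasles_fst h (Finset.Ico (min 0 b) (max 0 b)) 0 a a',
    sum2_chasles_fst h (Finset.Ico (min 0 b') (max 0 b')) 0 a a',
    sum2_chasles_snd h (Finset.Ico (min 0 a) (max 0 a)) 0 b b',
    sum2_chasles_snd h (Finset.Ico (min a a') (max a a')) 0 b b']
  generalize (∑ c ∈ Finset.Ico (min 0 a) (max 0 a), ∑ r ∈ Finset.Ico (min 0 b) (max 0 b), h c r) = α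
  generalize (∑ c ∈ Finset.Ico (min 0 a) (max 0 a), ∑ r ∈ Finset.Ico (min b b') (max b b'), h c r) = β
  generalize (∑ c ∈ Finset.Ico (min a a') (max a a'), ∑ r ∈ Finset.Ico (min 0 b) (max 0 b), h c r) = γ
  generalize (∑ c ∈ Finset.Ico (min a a') (max a a'), ∑ r ∈ Finset.Ico (min b b') (max b b'), h c r) = δ
  revert α β γ δ
  decide

/-- Exclusive-or bookkeeping for the colour formula. [folklore] -/
theorem xor_shear_aux (A B X₁ X₂ X₃ X₅ Y : Prop) :
    (Xor (A ∧ ¬X₁ ∨ X₁ ∧ ¬A) (Xor (B ∧ ¬Xor X₂ X₃ ∨ Xor X₂ X₃ ∧ ¬B)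
      (Xor (Xor X₁ (Xor X₂ (Xor X₃ X₅))) Y))) ↔ Xor A (Xor B (Xor Y X₅)) := by
  grind

/-- Parity of a sum of naturals as the parity of the number of odd summands (indicator form):
`Odd (Σ_i n_i) ↔ Odd #{i | Odd n_i}`. [folklore] -/
theorem odd_sum_iff_odd_sum_ite {ι : Type*} (s : Finset ι) (n : ι → ℕ) :
    Odd (∑ i ∈ s, n i) ↔ Odd (∑ i ∈ s, if Odd (n i) then 1 else 0) := by
  rw [← ZMod.natCast_eq_one_iff_odd, ← ZMod.natCast_eq_one_iff_odd, Nat.cast_sum, Nat.cast_sum]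
  have key : ∀ i, (((if Odd (n i) then 1 else 0 : ℕ)) : ZMod 2) = (n i : ZMod 2) := fun i => by
    by_cases hi : Odd (n i)
    · rw [if_pos hi, Nat.cast_one, (ZMod.natCast_eq_one_iff_odd).2 hi]
    · rw [if_neg hi, Nat.cast_zero, (ZMod.natCast_eq_zero_iff_even).2 (Nat.not_odd_iff_even.1 hi)]
  simp only [key]

/-- Parity of the marked points of a product rectangle as a parity of COLUMN parities (the column parity
predicate `Q` and the decidability instances are arbitrary). [folklore] -/
theorem odd_card_filter_product_cols (I J : Finset ℤ) (P : ℤ × ℤ → Prop) [DecidablePred P] (Q : ℤ → Prop)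
    [DecidablePred Q] (hQ : ∀ c, Q c ↔ Odd ((J.filter fun r => P (c, r)).card)) :
    Odd ((I ×ˢ J).filter P).card ↔ Odd (I.filter Q).card := by
  simp only [Finset.card_filter, Finset.sum_product]
  refine (odd_sum_iff_odd_sum_ite I _).trans (iff_of_eq (congrArg Odd (Finset.sum_congr rfl fun c _ => ?_)))
  refine if_congr ?_ rfl rfl
  rw [hQ c, Finset.card_filter]

/-- Parity of the marked points of a product rectangle as a parity of ROW parities (the row parity
predicate `Q` and the decidability instances are arbitrary). [folklore] -/
theorem odd_card_filter_product_rows (I J : Finset ℤ) (P : ℤ × ℤ → Prop) [DecidablePred P] (Q : ℤ → Prop)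
    [DecidablePred Q] (hQ : ∀ r, Q r ↔ Odd ((I.filter fun c => P (c, r)).card)) :
    Odd ((I ×ˢ J).filter P).card ↔ Odd (J.filter Q).card := by
  simp only [Finset.card_filter, Finset.sum_product_right]
  refine (odd_sum_iff_odd_sum_ite J _).trans (iff_of_eq (congrArg Odd (Finset.sum_congr rfl fun r _ => ?_)))
  refine if_congr ?_ rfl rfl
  rw [hQ r, Finset.card_filter]

/-! ## §B The registered sub-goals -/

/-- REGISTERED SUB-GOAL · the shear preserves the gauge measure (skew product: the shifts read the plaquette
coordinates only; `sitePercolation ℤ half` is invariant under `· ∆ T`, cf. `crsw_sitePercolation_half_map_symmDiff`,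
`IKQuarterTurn.measurePreserving_piecewise`, `DefectStubCurtain.exists_shear`). [folklore] -/
theorem screenShear_measurePreserving :
    ∀ (S : Set ℤ) (x₁ x₂ y₁ y₂ : ℤ), MeasurePreserving (screenShear S x₁ x₂ y₁ y₂) μIK μIK := by
  intro S x₁ x₂ y₁ y₂
  -- the shifts read the plaquette block `r = ω.2.2` only
  let cs : Set (Site 2) × (Set (Site 2) × Set (Site 2)) → Set ℤ := fun r =>
    colShift S x₁ x₂ y₁ y₂ (((∅ : Set ℤ), ((∅ : Set ℤ), r)) : Ω)
  let rs : Set (Site 2) × (Set (Site 2) × Set (Site 2)) → Set ℤ := fun r =>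
    rowShift S x₁ x₂ y₁ y₂ (((∅ : Set ℤ), ((∅ : Set ℤ), r)) : Ω)
  let gB : Set (Site 2) × (Set (Site 2) × Set (Site 2)) → Set ℤ → Set ℤ := fun r B => B ∆ rs r
  let F : Set ℤ × (Set (Site 2) × (Set (Site 2) × Set (Site 2))) →
      Set ℤ × (Set (Site 2) × (Set (Site 2) × Set (Site 2))) := fun q => (gB q.2 q.1, id q.2)
  let gA : Set ℤ × (Set (Site 2) × (Set (Site 2) × Set (Site 2))) → Set ℤ → Set ℤ := fun q A => A ∆ cs q.2
  have heq : screenShear S x₁ x₂ y₁ y₂ = fun p : Ω => (gA p.2 p.1, F p.2) := rfl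
  -- measurability of the internal parities as functions of the plaquette block
  have hin : ∀ R : Finset (ℤ × ℤ), Measurable fun r : Set (Site 2) × (Set (Site 2) × Set (Site 2)) =>
      inPar S x₁ x₂ y₁ y₂ (((∅ : Set ℤ), ((∅ : Set ℤ), r)) : Ω) R := fun R => by
    unfold inPar
    exact measurable_odd_card_filter (Q := fun (f : ℤ × ℤ) (r : Set (Site 2) × (Set (Site 2) × Set (Site 2))) =>
      plaq S (((∅ : Set ℤ), ((∅ : Set ℤ), r)) : Ω) f) (fun f =>
        (CouplingToLimits.measurable_mem_parSet S ![f.1, f.2]).comp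
          (measurable_const.prodMk (measurable_const.prodMk measurable_id))) _
  have hcsm : ∀ x : ℤ, Measurable fun r => x ∈ cs r := fun x => hin (rect0 x y₂)
  have hrsm : ∀ y : ℤ, Measurable fun r => y ∈ rs r := fun y =>
    CouplingToLimits.measurable_xor (hin (rect0 x₂ y)) (hin (rect0 x₂ y₂))
  have hgB : Measurable (Function.uncurry gB) := by
    refine measurable_set_iff.2 fun y => ?_
    simp only [Function.uncurry, gB, Set.mem_symmDiff]
    have ha : Measurable fun p : (Set (Site 2) × (Set (Site 2) × Set (Site 2))) × Set ℤ => y ∈ p.2 :=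
      (measurable_set_mem y).comp measurable_snd
    have hd : Measurable fun p : (Set (Site 2) × (Set (Site 2) × Set (Site 2))) × Set ℤ => y ∈ rs p.1 :=
      (hrsm y).comp measurable_fst
    exact (ha.and hd.not).or (hd.and ha.not)
  have hgA : Measurable (Function.uncurry gA) := by
    refine measurable_set_iff.2 fun x => ?_
    simp only [Function.uncurry, gA, Set.mem_symmDiff]
    have ha : Measurable fun p : (Set ℤ × (Set (Site 2) × (Set (Site 2) × Set (Site 2)))) × Set ℤ => x ∈ p.2 :=
      (measurable_set_mem x).comp measurable_snd
    have hd : Measurable fun p : (Set ℤ × (Set (Site 2) × (Set (Site 2) × Set (Site 2)))) × Set ℤ =>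
        x ∈ cs p.1.2 := (hcsm x).comp (measurable_snd.comp measurable_fst)
    exact (ha.and hd.not).or (hd.and ha.not)
  rw [heq]
  unfold μIK
  exact measurePreserving_swapSkew
    (measurePreserving_swapSkew (MeasurePreserving.id _) hgB fun r => crsw_sitePercolation_half_map_symmDiff (rs r))
    hgA fun q => crsw_sitePercolation_half_map_symmDiff (cs q.2)

/-- REGISTERED SUB-GOAL · THE COLOUR FORMULA after the shear. [folklore] -/
theorem mem_blackSet_screenShear :
    ∀ (S : Set ℤ) (x₁ x₂ y₁ y₂ : ℤ) (ω : Ω) (v : Site 2), v ∈ blackSet S (screenShear S x₁ x₂ y₁ y₂ ω) ↔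
      Xor (v 0 ∈ ω.1) (Xor (v 1 ∈ ω.2.1) (Xor (outPar S x₁ x₂ y₁ y₂ ω (rect0 (v 0) (v 1)))
        (inPar S x₁ x₂ y₁ y₂ ω (spanRect (v 0) (v 1) x₂ y₂)))) := by
  intro S x₁ x₂ y₁ y₂ ω v
  have hsplit := odd_filter_iff_xor_inPar_outPar S x₁ x₂ y₁ y₂ ω (rect0 (v 0) (v 1))
  have hkey := inPar_rect0_iff S x₁ x₂ y₁ y₂ ω (v 0) (v 1) x₂ y₂
  show Xor (v 0 ∈ ω.1 ∆ colShift S x₁ x₂ y₁ y₂ ω) (Xor (v 1 ∈ ω.2.1 ∆ rowShift S x₁ x₂ y₁ y₂ ω)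
    (Odd (((rect0 (v 0) (v 1)).filter (plaq S ω)).card))) ↔ _
  rw [hsplit, hkey]
  simp only [Set.mem_symmDiff, colShift, rowShift, Set.mem_setOf_eq]
  exact xor_shear_aux _ _ _ _ _ _ _

/-- The shear does not touch plaquettes: `parSet` is unchanged. [folklore] -/
theorem parSet_screenShear (S : Set ℤ) (x₁ x₂ y₁ y₂ : ℤ) (ω : Ω) :
    parSet S (screenShear S x₁ x₂ y₁ y₂ ω) = parSet S ω := rfl

/-- The shear does not touch coins: `antiSet` is unchanged. [folklore] -/
theorem antiSet_screenShear (S : Set ℤ) (x₁ x₂ y₁ y₂ : ℤ) (ω : Ω) :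
    antiSet S (screenShear S x₁ x₂ y₁ y₂ ω) = antiSet S ω := rfl

/-- REGISTERED SUB-GOAL · far cells ABOVE the near region see no internal plaquette. [folklore] -/
theorem inPar_span_far_top :
    ∀ (S : Set ℤ) (x₁ x₂ y₁ y₂ : ℤ) (ω : Ω) (v : Site 2), y₂ ≤ v 1 →
      ¬ inPar S x₁ x₂ y₁ y₂ ω (spanRect (v 0) (v 1) x₂ y₂) := by
  intro S x₁ x₂ y₁ y₂ ω v hv h
  unfold inPar at h
  obtain ⟨f, hf⟩ := Finset.card_pos.1 h.pos
  simp only [Finset.mem_filter, Finset.mem_inter, spanRect, intF, Finset.mem_product, Finset.mem_Ico] at hf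
  omega

/-- REGISTERED SUB-GOAL · far cells RIGHT of the near region see no internal plaquette. [folklore] -/
theorem inPar_span_far_right :
    ∀ (S : Set ℤ) (x₁ x₂ y₁ y₂ : ℤ) (ω : Ω) (v : Site 2), x₂ ≤ v 0 →
      ¬ inPar S x₁ x₂ y₁ y₂ ω (spanRect (v 0) (v 1) x₂ y₂) := by
  intro S x₁ x₂ y₁ y₂ ω v hv h
  unfold inPar at h
  obtain ⟨f, hf⟩ := Finset.card_pos.1 h.pos
  simp only [Finset.mem_filter, Finset.mem_inter, spanRect, intF, Finset.mem_product, Finset.mem_Ico] at hf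
  omega

/-- REGISTERED SUB-GOAL · far cells BELOW the near region see a parity of full internal COLUMN parities. [folklore] -/
theorem inPar_span_far_bottom :
    ∀ (S : Set ℤ) (x₁ x₂ y₁ y₂ : ℤ) (ω : Ω) (v : Site 2), v 1 < y₁ →
      (inPar S x₁ x₂ y₁ y₂ ω (spanRect (v 0) (v 1) x₂ y₂) ↔
        Odd (((Finset.Ico (min (v 0) x₂) (max (v 0) x₂) ∩ Finset.Ico x₁ (x₂ - 1)).filter
          (colParity S y₁ y₂ ω)).card)) := by
  intro S x₁ x₂ y₁ y₂ ω v hv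
  have hI : spanRect (v 0) (v 1) x₂ y₂ ∩ intF x₁ x₂ y₁ y₂ =
      (Finset.Ico (min (v 0) x₂) (max (v 0) x₂) ∩ Finset.Ico x₁ (x₂ - 1)) ×ˢ Finset.Ico y₁ (y₂ - 1) := by
    rw [spanRect, intF, Finset.product_inter_product]
    congr 1
    ext r
    simp only [Finset.mem_inter, Finset.mem_Ico]
    omega
  unfold inPar
  rw [hI]
  exact odd_card_filter_product_cols _ _ (plaq S ω) (colParity S y₁ y₂ ω) fun _ => Iff.rfl

/-- REGISTERED SUB-GOAL · far cells LEFT of the near region (in its row range) see a parity of full internal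
ROW parities. [folklore] -/
theorem inPar_span_far_left :
    ∀ (S : Set ℤ) (x₁ x₂ y₁ y₂ : ℤ) (ω : Ω) (v : Site 2), v 0 < x₁ → y₁ ≤ v 1 →
      (inPar S x₁ x₂ y₁ y₂ ω (spanRect (v 0) (v 1) x₂ y₂) ↔
        Odd (((Finset.Ico (v 1) (y₂ - 1)).filter (rowParity S x₁ x₂ ω)).card)) := by
  intro S x₁ x₂ y₁ y₂ ω v hv hv'
  have hI : spanRect (v 0) (v 1) x₂ y₂ ∩ intF x₁ x₂ y₁ y₂ =
      Finset.Ico x₁ (x₂ - 1) ×ˢ Finset.Ico (v 1) (y₂ - 1) := by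
    rw [spanRect, intF, Finset.product_inter_product]
    congr 1
    · ext c
      simp only [Finset.mem_inter, Finset.mem_Ico]
      omega
    · ext r
      simp only [Finset.mem_inter, Finset.mem_Ico]
      omega
  unfold inPar
  rw [hI]
  exact odd_card_filter_product_rows _ _ (plaq S ω) (rowParity S x₁ x₂ ω) fun _ => Iff.rfl

/-- REGISTERED SUB-GOAL · ADDITIVITY of the external part on the near region: for `x₁ ≤ v 0 < x₂`,
`y₁ ≤ v 1 < y₂`, `outPar (rect0 v) = C ⊕ F(v 0) ⊕ G(v 1)` (the piece `[x₁, v 0) × [y₁, v 1)` of `rect0 v` is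
internal). [folklore] -/
theorem outPar_rect0_near :
    ∀ (S : Set ℤ) (x₁ x₂ y₁ y₂ : ℤ) (ω : Ω) (v : Site 2), x₁ ≤ v 0 → v 0 < x₂ → y₁ ≤ v 1 → v 1 < y₂ →
      (outPar S x₁ x₂ y₁ y₂ ω (rect0 (v 0) (v 1)) ↔
        Xor (outPar S x₁ x₂ y₁ y₂ ω (rect0 x₁ y₁))
          (Xor (outPar S x₁ x₂ y₁ y₂ ω (Finset.Ico x₁ (v 0) ×ˢ Finset.Ico (min 0 y₁) (max 0 y₁)))
            (outPar S x₁ x₂ y₁ y₂ ω (Finset.Ico (min 0 x₁) (max 0 x₁) ×ˢ Finset.Ico y₁ (v 1))))) := by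
  intro S x₁ x₂ y₁ y₂ ω v h₁ h₂ h₃ h₄
  obtain ⟨k, H, Hz⟩ : ∃ k : ℤ → ℤ → ZMod 2,
      (∀ I J : Finset ℤ, (outPar S x₁ x₂ y₁ y₂ ω (I ×ˢ J) ↔ (∑ c ∈ I, ∑ r ∈ J, k c r) = 1)) ∧
        ∀ c r : ℤ, (c, r) ∈ intF x₁ x₂ y₁ y₂ → k c r = 0 :=
    ⟨_, outPar_product_iff S x₁ x₂ y₁ y₂ ω, fun c r h => if_neg (not_not_intro h)⟩
  simp only [rect0, H]
  rw [sum2_chasles_fst k (Finset.Ico (min 0 (v 1)) (max 0 (v 1))) 0 x₁ (v 0), min_eq_left h₁, max_eq_right h₁,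
    sum2_chasles_snd k (Finset.Ico (min 0 x₁) (max 0 x₁)) 0 y₁ (v 1),
    sum2_chasles_snd k (Finset.Ico x₁ (v 0)) 0 y₁ (v 1), min_eq_left h₃, max_eq_right h₃]
  have hz : ∑ c ∈ Finset.Ico x₁ (v 0), ∑ r ∈ Finset.Ico y₁ (v 1), k c r = 0 :=
    Finset.sum_eq_zero fun c hc => Finset.sum_eq_zero fun r hr => Hz c r (by
      simp only [intF, Finset.mem_product, Finset.mem_Ico] at hc hr ⊢; omega)
  rw [hz, add_zero]
  generalize (∑ c ∈ Finset.Ico (min 0 x₁) (max 0 x₁), ∑ r ∈ Finset.Ico (min 0 y₁) (max 0 y₁), k c r) = α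
  generalize (∑ c ∈ Finset.Ico (min 0 x₁) (max 0 x₁), ∑ r ∈ Finset.Ico y₁ (v 1), k c r) = β
  generalize (∑ c ∈ Finset.Ico x₁ (v 0), ∑ r ∈ Finset.Ico (min 0 y₁) (max 0 y₁), k c r) = γ
  revert α β γ
  decide

end Summit.CriticalPhenomena.CardyFormulaZ2.Theorems.IKLinearTransport.PinnedDiagramExchange.ScreeningGauge
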